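import Literature.Analysis.Fourier.DiscreteFractalUncertaintyProofs
import Literature.Analysis.Fourier.FractalUncertaintyPrincipleThm4
import HarnessLib

/-!
# Discharges of named facts of `DiscreteFractalUncertainty.lean`

`Literature/Analysis/Fourier/DiscreteFractalUncertaintyHolds.lean` — proofs-only sibling of
`DiscreteFractalUncertainty.lean` (no definitions, no named facts). Each theorem below closes
a named fact `X : Prop` of that file as `X_holds : X` by composing an ACCEPTED reduction
theorem of the tree with the ACCEPTED unconditional `_holds` discharges of all of its
hypotheses; nothing is re-proved and no statement is changed. Recorded by the librarian sweep
g25 (2026-08-16, pass 5c: facts dischargeable in one line from the tree's own lemmas), so that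
the facts census, `#h21_route_deps` and the cone guardrail see these facts as theorems.

Discharged here:

* `DyatlovJin2018_prop_4_8_holds` := `DyatlovJin2018_prop_4_8_of_bourgainDyatlov2018_thm4`
  `bourgainDyatlov2018_thm4_holds` (`DiscreteFractalUncertaintyProofs.lean`).

## References

* [DyatlovJin2018] — see `lean/references.bib` and the docstring of the fact in `DiscreteFractalUncertainty.lean`.
-/

namespace Literature.Analysis.Fourier

/-- **Discharge of the named fact `DyatlovJin2018_prop_4_8`** (`DiscreteFractalUncertainty.lean`):
Dyatlov–Jin 2018, Proposition 4.8 (discrete fractal uncertainty principle), verbatim: "Let `X,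
Y ⊂ ℤ_N` be `δ`-regular with constant `C_R` and `0 ≤ δ < 1`. … — obtained as
`DyatlovJin2018_prop_4_8_of_bourgainDyatlov2018_thm4` applied to the tree's unconditional
discharge `bourgainDyatlov2018_thm4_holds` of its hypothesis (reduction in
`DiscreteFractalUncertaintyProofs.lean`).
[cite: DyatlovJin2018, Prop. 4.8] -/
theorem DyatlovJin2018_prop_4_8_holds :
    DyatlovJin2018_prop_4_8 :=
  DyatlovJin2018_prop_4_8_of_bourgainDyatlov2018_thm4 bourgainDyatlov2018_thm4_holds

end Literature.Analysis.Fourier
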